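import Summits.BirchSwinnertonDyer.BirchSwinnertonDyer.Theorems.PrintCf2RubinValueTwoTwoVariableLayerRigidityPrime
import Summits.BirchSwinnertonDyer.BirchSwinnertonDyer.Theorems.PrintCf2RubinValueTwoTwoVariableLayerFamilyCyclotomic
import Literature.NumberTheory.EllipticCurves.IwasawaAlgebraSpecializationTorsionBoundProofs
import Mathlib.Algebra.CharP.Algebra
import HarnessLib

/-!
# Layer rigidity, part IV — THE CONSUMER FORM: `A ≠ 0`, `A·h = p^k·B` in `Λ₂`, and `(Ā) = (B̄)` on the cyclotomic layers `Λ₂/(Φ_{p^{n+1}}(1+T₂))`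
# for all LARGE `n` ⟹ `(A) = (B)` (the layer polynomials are Eisenstein, hence PRIME; a non-zero `A` is divisible by only finitely many of them)

Cell `bsd-print-cf2`, width seat `bsd-line-cf2c-w8` g6 (prover-bsd-line-cf2c-w8-g6-0); memo `Cruxes/MainConjClauseAtSplitTwoQuad/A-BRICK-PRINT-MAP-cf2c-w8g6.md` §5–§6
(«rigidity road» for M-LINE-PIN's stub (Q)). Parts I–III (p715747/p716015, p716256, p716694) prove THEOREM R′ for abstract layer families and reduce its
non-zero-divisor clause to `C φ_n ∤ A` for PRIME `φ_n`. Here: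
* §1 `Φ_{p^{n+1}}(1+X) = Σ_{i<p} (1+X)^{i pⁿ} ∈ ℤ_p[X]` is DISTINGUISHED and EISENSTEIN at `(p)` (`map_toZMod_cyclotomicLayerPoly`: `≡ X^{pⁿ(p−1)} (mod p)`;
  constant coefficient `p`), hence irreducible (`Polynomial.IsEisensteinAt.irreducible`) and **prime in `ℤ_p⟦T⟧`** (tree `IwasawaAlgebra.isPrime_span_coe`,
  Weierstrass): `prime_cyclotomicLayer`;
* §2 a non-zero `A ∈ Λ₂` is divisible by `C Φ_{p^{n+1}}(1+T₂)` for only FINITELY many `n` (`eq_zero_of_frequently_dvd`: else every `T₁`-coefficient lies in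
  `(p^k) + (Φ_n)` for all `k` and infinitely many `n` — LEMMA W′ — so is divisible by every `p^k`, hence `0`);
* §3 **`span_singleton_eq_of_dvd_of_eventually_layers`**: `A ≠ 0`, `A·h = p^k·B`, and `Ideal.span {Ā} = Ideal.span {B̄}` in `Λ₂/(C Φ_{p^{n+1}}(1+T₂))` for all
  `n ≥ n₀` ⟹ `Ideal.span {A} = Ideal.span {B}` — exactly what (C^alg) generic specialisation + (C^arith) control + Müller 2020 Thm 1.1 at the layers produce.
Pure algebra; THEOREMS ONLY; no `def`, no named fact, no `sorry`. No summit statement is proved; BSD is not proved by any of this. beyond-print theorem: no.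

References: [Washington1997] §7.1 (distinguished / Eisenstein polynomials, Prop. 7.2), §13.2.
-/

set_option autoImplicit false
-- the summit namespace `Summit.BirchSwinnertonDyer.BirchSwinnertonDyer` repeats the problem name by design (D-0017)
set_option linter.dupNamespace false

open PowerSeries Finset
open scoped Polynomial

namespace Summit.BirchSwinnertonDyer.BirchSwinnertonDyer.Theorems.PrintCf2.LayerRigidity

variable {p : ℕ} [hp : Fact p.Prime]

/-! ## §1. The cyclotomic layer polynomial is Eisenstein, hence prime in `ℤ_p⟦T⟧` -/

/-- `Σ_{i<p} (1+X)^{i pⁿ} ≡ X^{pⁿ(p−1)} (mod p)` as POLYNOMIALS. [cite: Washington1997, §7.1] -/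
theorem map_toZMod_cyclotomicLayerPoly (n : ℕ) :
    (∑ i ∈ range p, ((1 : ℤ_[p][X]) + Polynomial.X) ^ (i * p ^ n)).map (PadicInt.toZMod (p := p)) =
      Polynomial.X ^ (p ^ n * (p - 1)) := by
  have hpr : p.Prime := hp.out
  set u : (ZMod p)[X] := Polynomial.X ^ p ^ n with hu
  have hu0 : u ≠ 0 := pow_ne_zero _ Polynomial.X_ne_zero
  have hfrob : ((1 : (ZMod p)[X]) + Polynomial.X) ^ p ^ n = 1 + u := by
    rw [add_pow_char_pow, one_pow]
  have hterm : ∀ i : ℕ, (((1 : ℤ_[p][X]) + Polynomial.X) ^ (i * p ^ n)).map (PadicInt.toZMod (p := p)) = (1 + u) ^ i := by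
    intro i
    rw [Polynomial.map_pow, Polynomial.map_add, Polynomial.map_one, Polynomial.map_X, pow_mul', hfrob]
  rw [Polynomial.map_sum, Finset.sum_congr rfl fun i _ ↦ hterm i]
  have hgeom : u * ∑ i ∈ range p, (1 + u) ^ i = u ^ p := by
    have h := geom_sum_mul (1 + u) p
    rw [add_sub_cancel_left] at h
    rw [mul_comm, h, add_pow_char, one_pow, add_sub_cancel_left]
  have hsum : ∑ i ∈ range p, (1 + u) ^ i = u ^ (p - 1) := by
    apply mul_left_cancel₀ hu0
    rw [hgeom, ← pow_succ', Nat.sub_add_cancel hpr.one_le]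
  rw [hsum, hu, ← pow_mul]

/-- The coefficient of `X^{pⁿ(p−1)}` in `Σ_{i<p} (1+X)^{i pⁿ}` is `1` and higher coefficients vanish. [cite: Washington1997, §7.1] -/
theorem coeff_cyclotomicLayerPoly_of_le (n : ℕ) {j : ℕ} (hj : p ^ n * (p - 1) ≤ j) :
    (∑ i ∈ range p, ((1 : ℤ_[p][X]) + Polynomial.X) ^ (i * p ^ n)).coeff j = if j = p ^ n * (p - 1) then 1 else 0 := by
  have hpr : p.Prime := hp.out
  rw [Polynomial.finsetSum_coeff]
  have hcoeff : ∀ i ∈ range p, (((1 : ℤ_[p][X]) + Polynomial.X) ^ (i * p ^ n)).coeff j =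
      if i = p - 1 then (if j = p ^ n * (p - 1) then 1 else 0) else 0 := by
    intro i hi
    rw [add_comm, Polynomial.coeff_X_add_one_pow]
    have hi' : i ≤ p - 1 := Nat.le_sub_one_of_lt (mem_range.mp hi)
    by_cases h : i = p - 1
    · subst h
      rw [if_pos rfl, mul_comm]
      split_ifs with h'
      · rw [h', Nat.choose_self, Nat.cast_one]
      · rw [Nat.choose_eq_zero_of_lt (lt_of_le_of_ne hj (Ne.symm h')), Nat.cast_zero]
    · rw [if_neg h]
      have hlt : i * p ^ n < j := by
        calc i * p ^ n < (p - 1) * p ^ n := Nat.mul_lt_mul_of_pos_right (lt_of_le_of_ne hi' h) (pow_pos hpr.pos n)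
          _ = p ^ n * (p - 1) := mul_comm _ _
          _ ≤ j := hj
      rw [Nat.choose_eq_zero_of_lt hlt, Nat.cast_zero]
  rw [Finset.sum_congr rfl hcoeff, Finset.sum_ite_eq' (range p) (p - 1), if_pos (mem_range.mpr (Nat.sub_lt hpr.pos one_pos))]

/-- `Σ_{i<p} (1+X)^{i pⁿ}` is monic of degree `pⁿ(p−1)`. [cite: Washington1997, §7.1] -/
theorem natDegree_cyclotomicLayerPoly (n : ℕ) :
    (∑ i ∈ range p, ((1 : ℤ_[p][X]) + Polynomial.X) ^ (i * p ^ n)).natDegree = p ^ n * (p - 1) ∧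
      (∑ i ∈ range p, ((1 : ℤ_[p][X]) + Polynomial.X) ^ (i * p ^ n)).Monic := by
  set P := ∑ i ∈ range p, ((1 : ℤ_[p][X]) + Polynomial.X) ^ (i * p ^ n) with hP
  have hle : P.natDegree ≤ p ^ n * (p - 1) := by
    rw [Polynomial.natDegree_le_iff_coeff_eq_zero]
    intro j hj
    rw [hP, coeff_cyclotomicLayerPoly_of_le n hj.le, if_neg (Nat.ne_of_gt hj)]
  have hcoeff : P.coeff (p ^ n * (p - 1)) = 1 := by rw [hP, coeff_cyclotomicLayerPoly_of_le n le_rfl, if_pos rfl]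
  have hdeg : P.natDegree = p ^ n * (p - 1) :=
    le_antisymm hle (Polynomial.le_natDegree_of_ne_zero (by rw [hcoeff]; exact one_ne_zero))
  exact ⟨hdeg, by rw [Polynomial.Monic, Polynomial.leadingCoeff, hdeg, hcoeff]⟩

/-- `Σ_{i<p} (1+X)^{i pⁿ}` is DISTINGUISHED at `(p)`. [cite: Washington1997, §7.1] -/
theorem isDistinguishedAt_cyclotomicLayerPoly (n : ℕ) :
    (∑ i ∈ range p, ((1 : ℤ_[p][X]) + Polynomial.X) ^ (i * p ^ n)).IsDistinguishedAt (IsLocalRing.maximalIdeal ℤ_[p]) := by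
  obtain ⟨hdeg, hmonic⟩ := natDegree_cyclotomicLayerPoly (p := p) n
  refine ⟨⟨fun {i} hi ↦ ?_⟩, hmonic⟩
  rw [hdeg] at hi
  rw [← PadicInt.ker_toZMod, RingHom.mem_ker, ← Polynomial.coeff_map, map_toZMod_cyclotomicLayerPoly, Polynomial.coeff_X_pow,
    if_neg (Nat.ne_of_lt hi)]

/-- `Σ_{i<p} (1+X)^{i pⁿ}` is EISENSTEIN at `(p)` (constant coefficient `p`), hence irreducible. [cite: Washington1997, §7.1] -/
theorem irreducible_cyclotomicLayerPoly (n : ℕ) :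
    Irreducible (∑ i ∈ range p, ((1 : ℤ_[p][X]) + Polynomial.X) ^ (i * p ^ n)) := by
  have hpr : p.Prime := hp.out
  have hq := isDistinguishedAt_cyclotomicLayerPoly (p := p) n
  obtain ⟨hdeg, hmonic⟩ := natDegree_cyclotomicLayerPoly (p := p) n
  have hne : IsLocalRing.maximalIdeal ℤ_[p] ≠ ⊤ := (IsLocalRing.maximalIdeal.isMaximal ℤ_[p]).ne_top
  have hdpos : 0 < p ^ n * (p - 1) := Nat.mul_pos (pow_pos hpr.pos n) (Nat.sub_pos_of_lt hpr.one_lt)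
  -- the constant coefficient is `Σ_{i<p} 1 = p`
  have h0 : (∑ i ∈ range p, ((1 : ℤ_[p][X]) + Polynomial.X) ^ (i * p ^ n)).coeff 0 = (p : ℤ_[p]) := by
    rw [Polynomial.finsetSum_coeff]
    simp_rw [Polynomial.coeff_zero_eq_eval_zero, Polynomial.eval_pow, Polynomial.eval_add, Polynomial.eval_one, Polynomial.eval_X, add_zero,
      one_pow, Finset.sum_const, Finset.card_range, nsmul_eq_mul, mul_one]
  refine Polynomial.IsEisensteinAt.irreducible (𝓟 := IsLocalRing.maximalIdeal ℤ_[p]) ⟨?_, ?_, ?_⟩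
    (IsLocalRing.maximalIdeal.isMaximal ℤ_[p]).isPrime hmonic.isPrimitive (by rw [hdeg]; exact hdpos)
  · rw [hmonic.leadingCoeff]
    exact fun h ↦ hne ((Ideal.eq_top_iff_one _).mpr h)
  · exact fun hn ↦ hq.mem hn
  · rw [h0, PadicInt.maximalIdeal_eq_span_p, Ideal.span_singleton_pow, Ideal.mem_span_singleton]
    rintro ⟨c, hc⟩
    have hp0 : (p : ℤ_[p]) ≠ 0 := by exact_mod_cast hpr.ne_zero
    have h1 : (p : ℤ_[p]) * (1 - p * c) = 0 := by rw [mul_sub, mul_one, sub_eq_zero, ← mul_assoc, ← sq]; exact hc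
    rcases mul_eq_zero.mp h1 with h | h
    · exact hp0 h
    · exact PadicInt.irreducible_p.not_isUnit (IsUnit.of_mul_eq_one c (by linear_combination (-1 : ℤ_[p]) * h))

/-- The power series of the layer polynomial is the layer family member of part II. [cite: Washington1997, §7.1] -/
theorem coe_cyclotomicLayerPoly (n : ℕ) :
    ((∑ i ∈ range p, ((1 : ℤ_[p][X]) + Polynomial.X) ^ (i * p ^ n) : ℤ_[p][X]) : PowerSeries ℤ_[p]) =
      ∑ i ∈ range p, ((1 : PowerSeries ℤ_[p]) + X) ^ (i * p ^ n) := by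
  rw [show ((∑ i ∈ range p, ((1 : ℤ_[p][X]) + Polynomial.X) ^ (i * p ^ n) : ℤ_[p][X]) : PowerSeries ℤ_[p]) =
      Polynomial.coeToPowerSeries.ringHom (∑ i ∈ range p, ((1 : ℤ_[p][X]) + Polynomial.X) ^ (i * p ^ n)) from rfl, map_sum]
  refine Finset.sum_congr rfl fun i _ ↦ ?_
  rw [map_pow, map_add, map_one, Polynomial.coeToPowerSeries.ringHom_apply, Polynomial.coe_X]

/-- **`Φ_{p^{n+1}}(1+T) = Σ_{i<p} (1+T)^{i pⁿ}` is PRIME in `ℤ_p⟦T⟧`** (Eisenstein distinguished polynomial: `ℤ_p⟦T⟧/(Φ) ≅ ℤ_p[T]/(Φ)` by Weierstrass, tree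
`IwasawaAlgebra.isPrime_span_coe`). [cite: Washington1997, §7.1, Prop. 7.2] -/
theorem prime_cyclotomicLayer (n : ℕ) : Prime (∑ i ∈ range p, ((1 : PowerSeries ℤ_[p]) + X) ^ (i * p ^ n)) := by
  have hP := Literature.NumberTheory.EllipticCurves.IwasawaAlgebra.isPrime_span_coe p (isDistinguishedAt_cyclotomicLayerPoly (p := p) n)
    (irreducible_cyclotomicLayerPoly (p := p) n)
  have hcoe := coe_cyclotomicLayerPoly (p := p) n
  have hne : (∑ i ∈ range p, ((1 : PowerSeries ℤ_[p]) + X) ^ (i * p ^ n)) ≠ 0 := fun h ↦ by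
    have := layerFamily_cyclotomic (p := p) |>.1 n
    rw [h, map_zero] at this
    exact this rfl
  have hP' : (Ideal.span {∑ i ∈ range p, ((1 : PowerSeries ℤ_[p]) + X) ^ (i * p ^ n)}).IsPrime := by
    have e : (Ideal.span {((∑ i ∈ range p, ((1 : ℤ_[p][X]) + Polynomial.X) ^ (i * p ^ n) : ℤ_[p][X]) :
        Literature.NumberTheory.EllipticCurves.IwasawaAlgebra p)}) = Ideal.span {∑ i ∈ range p, ((1 : PowerSeries ℤ_[p]) + X) ^ (i * p ^ n)} := by
      rw [hcoe]
    rw [← e]; exact hP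
  exact (Ideal.span_singleton_prime hne).mp hP'

/-! ## §2. A non-zero `A ∈ Λ₂` is divisible by only finitely many layer primes -/

/-- In `ℤ_p⟦T⟧`: divisible by every power of `p` ⟹ zero. [folklore] -/
theorem eq_zero_of_forall_C_pow_dvd {f : PowerSeries ℤ_[p]} (h : ∀ k : ℕ, C ((p : ℤ_[p]) ^ k) ∣ f) : f = 0 := by
  ext m
  rw [map_zero]
  have hm : ∀ k : ℕ, (p : ℤ_[p]) ^ k ∣ coeff m f := fun k ↦ (C_dvd_iff_forall_dvd_coeff _ f).mp (h k) m
  by_contra hne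
  have hnorm : 0 < ‖coeff m f‖ := norm_pos_iff.mpr hne
  obtain ⟨k, hk⟩ := exists_pow_lt_of_lt_one hnorm (show ((p : ℝ))⁻¹ < 1 from
    inv_lt_one_of_one_lt₀ (by exact_mod_cast hp.out.one_lt))
  have hle : ‖coeff m f‖ ≤ (p : ℝ) ^ (-(k : ℤ)) :=
    (PadicInt.norm_le_pow_iff_mem_span_pow _ k).mpr (Ideal.mem_span_singleton.mpr (hm k))
  rw [zpow_neg, zpow_natCast, ← inv_pow] at hle
  exact absurd (lt_of_le_of_lt hle hk) (lt_irrefl _)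

/-- **A non-zero `A ∈ Λ₂` is divisible by `C Φ_{p^{n+1}}(1+T₂)` for only finitely many `n`**: if it were for arbitrarily large `n`, every `T₁`-coefficient of `A` would lie in
`(p^k) + (Φ_n)` for those `n` and every `k`, hence (LEMMA W′) be divisible by every `p^k`, hence vanish. [cite: Washington1997, §7.1] -/
theorem eq_zero_of_frequently_dvd {A : PowerSeries (PowerSeries ℤ_[p])}
    (h : ∀ n₀ : ℕ, ∃ n ≥ n₀, C (∑ i ∈ range p, ((1 : PowerSeries ℤ_[p]) + X) ^ (i * p ^ n)) ∣ A) : A = 0 := by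
  have hpr : p.Prime := hp.out
  -- the sub-family of layer relations dividing `A`
  choose e he hdvd using h
  have hφ₁ : ∀ m, PowerSeries.map (PadicInt.toZMod (p := p)) (∑ i ∈ range p, ((1 : PowerSeries ℤ_[p]) + X) ^ (i * p ^ (e m))) ≠ 0 :=
    fun m ↦ layerFamily_cyclotomic.1 (e m)
  have hφ₂ : ∀ N : ℕ, ∃ m, (X : PowerSeries (ZMod p)) ^ N ∣
      PowerSeries.map (PadicInt.toZMod (p := p)) (∑ i ∈ range p, ((1 : PowerSeries ℤ_[p]) + X) ^ (i * p ^ (e m))) := fun N ↦ ⟨N, by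
    rw [map_toZMod_cyclotomicLayer]
    refine pow_dvd_pow X (le_trans ?_ (Nat.le_mul_of_pos_right _ (Nat.sub_pos_of_lt hpr.one_lt)))
    exact le_trans (he N) (Nat.lt_pow_self hpr.one_lt).le⟩
  refine PowerSeries.ext fun m ↦ ?_
  rw [map_zero]
  refine eq_zero_of_forall_C_pow_dvd fun k ↦ dvd_of_forall_mem_sup_span (fun j ↦ ∑ i ∈ range p, ((1 : PowerSeries ℤ_[p]) + X) ^ (i * p ^ (e j)))
    hφ₁ hφ₂ k (coeff m A) fun j ↦ ?_
  have hj : (∑ i ∈ range p, ((1 : PowerSeries ℤ_[p]) + X) ^ (i * p ^ (e j))) ∣ coeff m A :=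
    (C_dvd_iff_forall_dvd_coeff _ A).mp (hdvd j) m
  exact Ideal.mem_sup_right (Ideal.mem_span_singleton.mpr hj)

/-! ## §3. The consumer form: layer equalities for all large `n` -/

/-- **LAYER RIGIDITY, CONSUMER FORM.** `A ≠ 0` in `Λ₂ = ℤ_p⟦T₂⟧⟦T₁⟧`, `A·h = p^k·B`, and for all `n ≥ n₀` the principal ideals of `A` and `B` agree in the layer
`Λ₂/(C Φ_{p^{n+1}}(1+T₂))` ⟹ `(A) = (B)` in `Λ₂`. (The layers with `C Φ_n ∤ A` are cofinitely many by §2; they form a prime layer family; part III.)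
[cite: Washington1997, §13.2 (shape); §7.1] -/
theorem span_singleton_eq_of_dvd_of_eventually_layers {A B h : PowerSeries (PowerSeries ℤ_[p])} {k : ℕ} (hA : A ≠ 0)
    (hAB : A * h = C (C ((p : ℤ_[p]) ^ k)) * B) {n₀ : ℕ}
    (hline : ∀ n ≥ n₀,
      Ideal.span {Ideal.Quotient.mk (Ideal.span {C (∑ i ∈ range p, ((1 : PowerSeries ℤ_[p]) + X) ^ (i * p ^ n))}) A} =
        Ideal.span {Ideal.Quotient.mk (Ideal.span {C (∑ i ∈ range p, ((1 : PowerSeries ℤ_[p]) + X) ^ (i * p ^ n))}) B}) :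
    Ideal.span {A} = Ideal.span {B} := by
  have hpr : p.Prime := hp.out
  -- beyond some `n₁`, no layer relation divides `A`
  have hfin : ∃ n₁, ∀ n ≥ n₁, ¬ C (∑ i ∈ range p, ((1 : PowerSeries ℤ_[p]) + X) ^ (i * p ^ n)) ∣ A := by
    by_contra hcon
    refine hA (eq_zero_of_frequently_dvd fun n₀ ↦ ?_)
    by_contra h'
    exact hcon ⟨n₀, fun n hn hdvd ↦ h' ⟨n, hn, hdvd⟩⟩
  obtain ⟨n₁, hn₁⟩ := hfin
  -- the good layers `n ≥ max n₀ n₁`, re-indexed by `j ↦ max n₀ n₁ + j`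
  refine span_singleton_eq_of_dvd_of_primeLayers (fun j ↦ ∑ i ∈ range p, ((1 : PowerSeries ℤ_[p]) + X) ^ (i * p ^ (max n₀ n₁ + j)))
    (fun j ↦ prime_cyclotomicLayer _) (fun j ↦ layerFamily_cyclotomic.1 _) (fun N ↦ ⟨N, ?_⟩) hAB fun j ↦
    ⟨hline _ (le_trans (le_max_left _ _) (Nat.le_add_right _ _)), hn₁ _ (le_trans (le_max_right _ _) (Nat.le_add_right _ _))⟩
  rw [map_toZMod_cyclotomicLayer]
  refine pow_dvd_pow X (le_trans ?_ (Nat.le_mul_of_pos_right _ (Nat.sub_pos_of_lt hpr.one_lt)))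
  exact le_trans (Nat.le_add_left N _) (Nat.lt_pow_self hpr.one_lt).le

end Summit.BirchSwinnertonDyer.BirchSwinnertonDyer.Theorems.PrintCf2.LayerRigidity
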